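import Summits.QuantumFields.YangMills.Theorems.BalabanUVNodesN12NearFlatDelta2LetterComponent

/-!
# DAG node N12 [B15] — THE CHART LETTERS OF THE DIRECT ROAD WITHOUT THE GLOBAL SMALL-BELOW GUARD: regularity, the fibre clause and the Lagrange multiplier of the canonical multi-scale
# chart `Ψ_{𝐁,W,U}` at `U` FROM ONE GUARDED PROXY PER CONSTRAINED BOND (lane finding LOCATED-HSB, repair pen ρ5a)

[Balaban1985Variational] = «[15]», Sect. C (44)–(48) p. 285, (81)–(83) p. 290; [Balaban1988Convergent] = «[III]», (2.10)–(2.13) pp. 256–257; [Balaban1989LargeFieldII] = «[LF-II]»,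
(1.12) p. 359.

Cell `pub-ymgap`, HUMAN RULINGS D-0062 ∕ D-0149, lane owner `pub-ymgap-dag-n12-c` (g21) on node N12.  Key K1⁹ `stmt-QuantumFields-27364`, `--kind proof --supports … --as helper`;
count-neutral.  NEW leaf; CONSUMED BY NAME, nothing modified: n07-w2's `Node00.MultiScaleFibreChart` (`contDiffAt_msChart`, `eventually_norm_relAvg_sub_one_le`, `msChart_zero_of_agreeOn`,
`eq_one_of_suProj_mlog_eq_zero`, `avg_eq_of_relAvg_eq_one`), `Node00.MultiScaleFibreChartLagrange` (`exists_lam_of_isFibreChartNear_of_isCritOnFibre`,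
`isCritOnFibre_of_isMinimizer_regMSCoPOfRecord`), dag-n12-w4's `N12NearFlatDelta2LetterComponent.msChart_apply_eq_of_eqOn_feeds_of_fibre` (the component locality [III] (2.11)).

WHY (LOCATED-HSB, lane census 2026-08-28).  The direct road's chart rows, its (P4)′ right inverse and its (P5) curvature all display `hsb : SmallBelow (avOfRecord F N K) k U₀` for every
guarded minimiser `U₀` — the (0.4) small-field condition of EVERY iterated average at EVERY coarse bond of the torus, also far outside the support where the (2.12) class says nothing:
plausible, not class-derivable, no producer.  dag-n12-w4's `Node00.MultiScaleFibreChartLocality` removes it given ONE guarded proxy agreeing with `U₀` on ALL of `inputs 𝐁` — which a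
bondwise near-flat gauge over the whole constraint region would supply, and that gauge does not exist in general (the lane's holonomy obstruction, `B15Prop1HolonomyObstruction`).  THIS FILE
asks instead for ONE GUARDED PROXY PER CONSTRAINED BOND `(j, c)`, agreeing with `U` on the tower `feeds j c` only: each component of `Ψ_{𝐁,W,U}` reads `U` on its own tower ([III] (2.11)),
so each component of the chart at `U` IS the corresponding component of the chart at the proxy (in the proxy's own fibre), and `C^∞`-regularity, the derivative letters, the fibre clause
and the Lagrange multiplier transfer componentwise.  Towers are boxes: a per-tower axial gauge has no holonomy obstruction, so the per-bond proxies ARE class-derivable (pen ρ5b).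

CONTENTS (namespace `Summit.QuantumFields.YangMills.BalabanUVNodes.N12ChartRegularityTowerProxies`; theorems only — no `def`, no `instance`, no `sorry`).  Standing hypotheses of §2–§3:
`hk : k ≤ m + K`, `hU : AgreeOn 𝐁 (M˙U) W`, `hprox : ∀ i, ∃ U′, (U′ = U on feeds j_i c_i) ∧ SmallBelow k U′`.
* §1 `relAvg_expChart_eq_of_eqOn_feeds_of_fibre`, `msChart_component_eq_of_towerProxy` (function-level component identity).
* §2 ★★ `chartLetters_msChart_of_towerProxies` (BUNDLED: `C^∞` at `0` ∧ `HasStrictFDerivAt` ∧ the J-C pair `hΨ₂`∕`hΨd` ∧ the fibre clause) and ★★★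
  `fibreChart_and_lam_msChart_of_towerProxies` (`IsFibreChartNear` ∧ (curve-critical → Lagrange multiplier)) — the shapes of NODE 00's chart letters WITHOUT `SmallBelow k U`; bundled
  because each conjunct alone has the conclusion text of the corresponding `_of_proxy` letter of `Node00.MultiScaleFibreChartLocality` (whose hypothesis — ONE proxy on all of
  `inputs 𝐁` — is the stronger one this file avoids).
* §3 ★★★ `exists_lam_msChart_Bj_of_isMinimizer_regMSCoPOfRecord_of_towerProxies` (the direct chart rows' multiplier WITHOUT `hsb`).

HONEST FRAMING ∕ LOCATED.  Kernel calculus and lattice bookkeeping over landed NODE 00 modules; the per-bond proxies are HYPOTHESES here (their production from the class is pen ρ5b);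
nothing of Bałaban's asserted; count-neutral helper; N12 NOT discharged; K1⁹ NOT closed; counts unmoved; one finite 𝕋⁴ programme at fixed ε — R4 closes the conditional finite-𝕋⁴
rung `BalabanLadder.UV` only; NOT continuum ∕ OS ∕ mass gap ∕ Clay.
-/

noncomputable section

open scoped BigOperators Matrix.Norms.L2Operator Topology
open Filter Finset

namespace Summit.QuantumFields.YangMills.BalabanUVNodes.N12ChartRegularityTowerProxies

open Literature.MathematicalPhysics.QuantumFieldTheory.Balaban1983to89
open T4Continuum (T4Family)
open T4AdjointCovarianceUnitary (lieSU)
open B15DeterminingSets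
open B14.Eq213DetSet (Bj Bj_of_gt)
open B14.Eq216Concrete (feeds inputs iter_local)
open Node00
open Summit.QuantumFields.YangMills.BalabanUVNodes.N12NearFlatDelta2LetterComponent (msChart_apply_eq_of_eqOn_feeds_of_fibre)

variable {F : T4Family} {N : ℕ} [NeZero N] {K k : ℕ} {𝔹 : DetSet (F.P K)} {W : MSField (F.P K) (SU N)} {U : GaugeField (F.P K) 0 (SU N)}

/-! ## §1  Component locality of the relative averages and of the chart -/

/-- **THE RELATIVE AVERAGE AT A CONSTRAINED BOND READS `U` ON ITS TOWER**: if `U′ = U` on `feeds j_i c_i` and `W = M˙U` on `𝐁`, then for every `X`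
`W_{j_i}(c_i)*·Ū^{j_i}(U·e^X)(c_i) = (M˙U′)_{j_i}(c_i)*·Ū^{j_i}(U′·e^X)(c_i)`. [cite: Balaban1988Convergent, (2.10)–(2.11) p.256] -/
theorem relAvg_expChart_eq_of_eqOn_feeds_of_fibre (hk : k ≤ (F.P K).m + (F.P K).K) (hU : AgreeOn 𝔹 (avgFamily (avOfRecord F N K) U) W)
    (i : Fin (constrCard 𝔹 k)) {U' : GaugeField (F.P K) 0 (SU N)}
    (hin : ∀ b ∈ feeds (((constrEnum 𝔹 k).symm i).1 : ℕ) ((constrEnum 𝔹 k).symm i).2.1, U' b = U b) (X : PBond (F.P K) 0 → lieSU (Fin N)) :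
    relAvg K W (expChart U X) (((constrEnum 𝔹 k).symm i).1 : ℕ) ((constrEnum 𝔹 k).symm i).2.1
      = relAvg K (avgFamily (avOfRecord F N K) U') (expChart U' X) (((constrEnum 𝔹 k).symm i).1 : ℕ) ((constrEnum 𝔹 k).symm i).2.1 := by
  have hj : (((constrEnum 𝔹 k).symm i).1 : ℕ) ≤ (F.P K).m + (F.P K).K := (Nat.le_of_lt_succ ((constrEnum 𝔹 k).symm i).1.2).trans hk
  have hW : W (((constrEnum 𝔹 k).symm i).1 : ℕ) ((constrEnum 𝔹 k).symm i).2.1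
      = avgFamily (avOfRecord F N K) U' (((constrEnum 𝔹 k).symm i).1 : ℕ) ((constrEnum 𝔹 k).symm i).2.1 := by
    rw [← hU _ _ ((constrEnum 𝔹 k).symm i).2.2]
    exact iter_local (avOfRecord F N K) _ hj _ _ _ fun b hb => (hin b hb).symm
  have hav : avgFamily (avOfRecord F N K) (expChart U X) (((constrEnum 𝔹 k).symm i).1 : ℕ) ((constrEnum 𝔹 k).symm i).2.1
      = avgFamily (avOfRecord F N K) (expChart U' X) (((constrEnum 𝔹 k).symm i).1 : ℕ) ((constrEnum 𝔹 k).symm i).2.1 :=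
    iter_local (avOfRecord F N K) _ hj _ _ _ fun b hb => by unfold expChart; rw [hin b hb]
  rw [relAvg, relAvg, hW, hav]

/-- **THE `i`-TH COMPONENT OF THE CHART AT `U` IS, AS A FUNCTION, THE `i`-TH COMPONENT OF THE CHART AT ANY PROXY AGREEING ON THE TOWER** (in the proxy's own fibre).
[cite: Balaban1988Convergent, (2.10)–(2.11) p.256; Balaban1985Variational, (47) p.285] -/
theorem msChart_component_eq_of_towerProxy (hk : k ≤ (F.P K).m + (F.P K).K) (hU : AgreeOn 𝔹 (avgFamily (avOfRecord F N K) U) W)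
    (i : Fin (constrCard 𝔹 k)) {U' : GaugeField (F.P K) 0 (SU N)}
    (hin : ∀ b ∈ feeds (((constrEnum 𝔹 k).symm i).1 : ℕ) ((constrEnum 𝔹 k).symm i).2.1, U' b = U b) :
    (fun X => msChart F N K k 𝔹 W U X i) = fun X => msChart F N K k 𝔹 (avgFamily (avOfRecord F N K) U') U' X i :=
  funext fun X => msChart_apply_eq_of_eqOn_feeds_of_fibre hk hU i hin X

/-! ## §2  Regularity, the fibre clause and the multiplier of the chart at `U` from one guarded proxy per constrained bond (BUNDLED conclusions) -/

section Proxies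

variable (hk : k ≤ (F.P K).m + (F.P K).K) (hU : AgreeOn 𝔹 (avgFamily (avOfRecord F N K) U) W)
  (hprox : ∀ i : Fin (constrCard 𝔹 k), ∃ U' : GaugeField (F.P K) 0 (SU N),
    (∀ b ∈ feeds (((constrEnum 𝔹 k).symm i).1 : ℕ) ((constrEnum 𝔹 k).symm i).2.1, U' b = U b) ∧ SmallBelow (avOfRecord F N K) k U')
include hk hU hprox

/-- ★★ **THE CHART LETTERS AT `U` FROM ONE GUARDED PROXY PER CONSTRAINED BOND** (bundled): the chart is `C^∞` at `0` (componentwise: each component is the proxy chart's component), hence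
strictly differentiable at `0` with derivative `DΨ(0)`, `Y ↦ DΨ(Y)` is differentiable at `0` with derivative `D²Ψ(0)` and `Ψ` is differentiable near `0` (the J-C pair `hΨ₂` ∕ `hΨd`), and —
for `𝐁` with no member above `k` — the level set through `0` lies in the fibre near `0` (the relative average at `(j_i, c_i)` is the proxy's, hence `ρ_N`-close to `1` near `0`, where
`π log` is injective).  The shapes are those of `Node00.contDiffAt_msChart` ∕ `hasStrictFDerivAt_msChart` ∕ `regularity_binders_msChart` ∕ `eventually_agreeOn_of_msChart_eq`, WITHOUT
`SmallBelow k U`. [cite: Balaban1985Variational, Sect. C p.285, (3) p.278, (81)–(83) p.290; Balaban1988Convergent, (2.10)–(2.11) p.256] -/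
theorem chartLetters_msChart_of_towerProxies :
    ContDiffAt ℝ ⊤ (msChart F N K k 𝔹 W U) 0 ∧
    HasStrictFDerivAt (msChart F N K k 𝔹 W U) (fderiv ℝ (msChart F N K k 𝔹 W U) 0) 0 ∧
    (HasFDerivAt (fun Y => fderiv ℝ (msChart F N K k 𝔹 W U) Y) (fderiv ℝ (fderiv ℝ (msChart F N K k 𝔹 W U)) 0) 0 ∧
      ∀ᶠ Y in 𝓝 (0 : PBond (F.P K) 0 → lieSU (Fin N)), DifferentiableAt ℝ (msChart F N K k 𝔹 W U) Y) ∧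
    ((∀ j, k < j → 𝔹 j = ∅) → ∀ᶠ X in 𝓝 (0 : PBond (F.P K) 0 → lieSU (Fin N)),
      msChart F N K k 𝔹 W U X = msChart F N K k 𝔹 W U 0 → AgreeOn 𝔹 (avgFamily (avOfRecord F N K) (expChart U X)) W) := by
  -- `C^∞` at `0`, componentwise through the proxies
  have hC : ContDiffAt ℝ ⊤ (msChart F N K k 𝔹 W U) 0 := by
    refine contDiffAt_pi.2 fun i => ?_
    obtain ⟨U', hin, hsb'⟩ := hprox i
    rw [msChart_component_eq_of_towerProxy hk hU i hin]
    have h := contDiffAt_msChart (K := K) (k := k) (𝔹 := 𝔹) (W := avgFamily (avOfRecord F N K) U') (U := U') (fun _ _ _ => rfl) hsb'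
    exact contDiffAt_pi.1 h i
  have h2 : ContDiffAt ℝ 2 (msChart F N K k 𝔹 W U) 0 := hC.of_le le_top
  refine ⟨hC, hC.hasStrictFDerivAt (by simp), ⟨((h2.fderiv_right (m := 1) (by norm_num)).differentiableAt (by norm_num)).hasFDerivAt,
    (h2.eventually (by simp)).mono fun Y hY => hY.differentiableAt (by norm_num)⟩, fun h𝔹 => ?_⟩
  -- the fibre clause: near `0`, every relative average of `U·e^X` at a constrained bond is `ρ_N`-close to `1` (through the proxies)
  have hnear : ∀ᶠ X in 𝓝 (0 : PBond (F.P K) 0 → lieSU (Fin N)), ∀ i : Fin (constrCard 𝔹 k),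
      ‖relAvg K W (expChart U X) (((constrEnum 𝔹 k).symm i).1 : ℕ) ((constrEnum 𝔹 k).symm i).2.1 - 1‖ ≤ rhoSU N := by
    refine eventually_all.2 fun i => ?_
    obtain ⟨U', hin, hsb'⟩ := hprox i
    have h := eventually_norm_relAvg_sub_one_le (K := K) (k := k) (𝔹 := 𝔹) (W := avgFamily (avOfRecord F N K) U') (U := U') (fun _ _ _ => rfl) hsb'
    filter_upwards [h] with X hX
    rw [relAvg_expChart_eq_of_eqOn_feeds_of_fibre hk hU i hin X]
    exact hX i
  refine hnear.mono fun X hX hΦ j c hc => ?_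
  by_cases hj : j ≤ k
  · set s : ConstrSet 𝔹 k := ⟨⟨j, Nat.lt_succ_of_le hj⟩, c, hc⟩ with hs
    have hi := congrFun hΦ (constrEnum 𝔹 k s)
    rw [msChart_zero_of_agreeOn hU] at hi
    rw [msChart_apply, Equiv.symm_apply_apply] at hi
    have hρ := hX (constrEnum 𝔹 k s)
    rw [Equiv.symm_apply_apply] at hρ
    exact avg_eq_of_relAvg_eq_one (eq_one_of_suProj_mlog_eq_zero (relAvg_mem_SU _ _ _) hρ hi)
  · exfalso
    have he : 𝔹 j = ∅ := h𝔹 j (lt_of_not_ge hj)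
    rw [he] at hc
    simp [bondsOf] at hc

/-- ★★★ **`IsFibreChartNear` AND THE LAGRANGE MULTIPLIER AT `U` WITHOUT ANY GLOBAL GUARD** (bundled): for `𝐁` with no member above `k ≤ m + K`, `U` in the fibre, one guarded proxy per
constrained bond and `DΨ(0)` onto, the canonical chart is a submersive chart of the fibre near `U`, and if moreover `U` is curve-critical on the fibre then `D(A∘expChart U)(0) = λ ∘ DΨ(0)`
for some continuous linear `λ` — the shapes of `Node00.isFibreChartNear_msChart_of_surjective` ∕ `exists_lam_msChart_of_surjective` without `SmallBelow k U`.
[cite: Balaban1985Variational, (45)–(48) p.285, (82)–(83) p.290, p.300; Balaban1989LargeFieldII, (1.12) p.359; Balaban1988Convergent, (2.10)–(2.12) p.256] -/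
theorem fibreChart_and_lam_msChart_of_towerProxies (h𝔹 : ∀ j, k < j → 𝔹 j = ∅)
    (hsurj : Function.Surjective (fderiv ℝ (msChart F N K k 𝔹 W U) 0)) :
    IsFibreChartNear F N K 𝔹 W U (msChart F N K k 𝔹 W U) (fderiv ℝ (msChart F N K k 𝔹 W U) 0) ∧
    (IsCritOnFibre F N K 𝔹 W U → ∃ lam : (Fin (constrCard 𝔹 k) → lieSU (Fin N)) →L[ℝ] ℝ,
      fderiv ℝ (fun Y : PBond (F.P K) 0 → lieSU (Fin N) => wilsonAction4 (expChart U Y)) 0 = lam.comp (fderiv ℝ (msChart F N K k 𝔹 W U) 0)) := by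
  obtain ⟨-, hstrict, -, hfib⟩ := chartLetters_msChart_of_towerProxies hk hU hprox
  have hnear : IsFibreChartNear F N K 𝔹 W U (msChart F N K k 𝔹 W U) (fderiv ℝ (msChart F N K k 𝔹 W U) 0) :=
    ⟨hstrict, LinearMap.range_eq_top.2 hsurj, hfib h𝔹⟩
  exact ⟨hnear, fun hcrit => exists_lam_of_isFibreChartNear_of_isCritOnFibre hnear hcrit⟩

end Proxies

/-- ★★★ **THE DIRECT CHART ROWS' MULTIPLIER `hlam` AT `𝐁_k(Z)` FOR A (2.12) MINIMISER, WITHOUT `SmallBelow k U₀`** — `Node00.exists_lam_msChart_Bj_of_isMinimizer_regMSCoPOfRecord` with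
the global guard `hsb` REPLACED by one guarded proxy per constrained bond; curve-criticality from minimality over the class of record (`isCritOnFibre_of_isMinimizer_regMSCoPOfRecord`).
[cite: Balaban1985Variational, (82)–(83) p.290; Balaban1989LargeFieldII, (1.12) p.359; Balaban1988Convergent, (2.12)–(2.13) pp.256–257] -/
theorem exists_lam_msChart_Bj_of_isMinimizer_regMSCoPOfRecord_of_towerProxies (ν : Stage7Numerics) {k' : ℕ} (Ω : ℕ → Set (Site (F.P K) 0))
    (M₁ : ℕ) (Z : Set (Site (F.P K) 0)) {W : MSField (F.P K) (SU N)} {U₀ : GaugeField (F.P K) 0 (SU N)} (hk : k ≤ (F.P K).m + (F.P K).K)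
    (h : IsMinimizer (avOfRecord F N K) (regMSCoPOfRecord F N ν K k' Ω) (Bj M₁ Z k) W U₀)
    (hprox : ∀ i : Fin (constrCard (Bj M₁ Z k) k), ∃ U' : GaugeField (F.P K) 0 (SU N),
      (∀ b ∈ feeds (((constrEnum (Bj M₁ Z k) k).symm i).1 : ℕ) ((constrEnum (Bj M₁ Z k) k).symm i).2.1, U' b = U₀ b) ∧ SmallBelow (avOfRecord F N K) k U')
    (hsurj : Function.Surjective (fderiv ℝ (msChart F N K k (Bj M₁ Z k) W U₀) 0)) :
    ∃ lam : (Fin (constrCard (Bj M₁ Z k) k) → lieSU (Fin N)) →L[ℝ] ℝ,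
      fderiv ℝ (fun Y : PBond (F.P K) 0 → lieSU (Fin N) => wilsonAction4 (expChart U₀ Y)) 0 = lam.comp (fderiv ℝ (msChart F N K k (Bj M₁ Z k) W U₀) 0) :=
  (fibreChart_and_lam_msChart_of_towerProxies hk h.2.1 hprox (fun _ hj => Bj_of_gt hj) hsurj).2 (isCritOnFibre_of_isMinimizer_regMSCoPOfRecord ν Ω h)

end Summit.QuantumFields.YangMills.BalabanUVNodes.N12ChartRegularityTowerProxies

end
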